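import Mathlib.NumberTheory.Padics.PadicNumbers
import Literature.NumberTheory.EllipticCurves.ModularCurve
import HarnessLib

/-!
# The Néron period versus the lattice period of the newform at a prime `p ∤ N` with `E[p]` irreducible

Topic `NumberTheory/EllipticCurves`; namespace `Literature.NumberTheory.EllipticCurves`. One named
fact (`def … : Prop`, D-0014), stated for the crux `SelmerRankLB` of `BirchSwinnertonDyer`
(stmt-BirchSwinnertonDyer-0131, line `kurihara_order`, stubs K and V2a:
`Summits/BirchSwinnertonDyer/BirchSwinnertonDyer/Theorems/SelmerRankSelmerRankLBStubKimOrder.lean`),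
where it feeds the period hypothesis `Ω(W) = u · Ω⁺_f`, `|u|_p = 1`, of the Kim-type facts
`Kim2022_kuriharaNumber_certificate` (`KuriharaNumberKimCertificate`),
`Kim2022_selmerCorank_le_of_kuriharaNumber_ne_zero` (`KuriharaNumberKimStructure`) and
`Kim2022_exists_kuriharaNumber_ne_zero_of_selmerCorank` (`KuriharaNumberKimNonvanishing`).

## The two periods

* `Ω(W) = W.realPeriodRat = ∫_{E(ℝ)} |ω|` (`BSDInvariants`): the real period of the invariant
  differential `ω = dx/(2y + a₁x + a₃)` of the model `W`, number of real components included; for a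
  GLOBALLY MINIMAL `W` this is the Néron period `Ω⁺_E` of Kim 2022 §1.4.1, Greenberg–Vatsal 2000
  §3, Skinner–Urban 2014.
* `Ω⁺_f = plusPeriod f` (`ModularSymbols`): the positive real number with `re Λ_f = ℤ · Ω⁺_f/2`
  for the period lattice `Λ_f = {∫_γ 2πi f dz : γ ∈ H₁(X₀(N), ℤ)}` of `f` — the same
  "components included" normalisation applied to the lattice `Λ_f`, i.e. the Néron-type period of
  the torus `ℂ/Λ_f`.

## The printed chain (why the ratio is a rational `p`-adic unit)

Let `W/ℚ` be globally minimal and elliptic, `f ∈ S₂(Γ₀(N))` its newform (`IsNewformOf W f`;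
then `N = N_E`, Carayol 1986), `p ≥ 5` a prime of good reduction (`p ∤ N`) with `E[p]`
irreducible.
1. `Λ_f` is `c₀⁻¹` times the Néron lattice of the `X₀(N)`-optimal (strong Weil) curve `E₀` of the
   isogeny class, `Λ(ω_{E₀}) = c₀ Λ_f` with `c₀ ∈ ℤ ∖ {0}` the Manin constant (Edixhoven 1991,
   Prop. 2; tree: `ModularParametrizationData`, `exists_optimalDatum'`,
   `ModularParametrizationData.realPeriodRat_dvd`); hence `Ω(E₀) = |c₀| · Ω⁺_f`.
2. `p ∤ c₀` because `p ∤ N` (Abbes–Ullmo 1996, Thm. A: the Manin constant of the strong Weil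
   curve is prime to every prime not dividing the conductor; for odd `p` with `p² ∤ N` already
   Mazur 1978, Cor. 4.1; tree named facts `abbesUllmo_not_dvd_maninConstant_of_not_dvd_level`,
   `mazur_not_dvd_maninConstant_of_odd`; survey Agashe–Ribet–Stein 2006, Thm. 2.6).
3. `W` and `E₀` have the same newform, hence are `ℚ`-isogenous (Faltings 1983); a cyclic
   `ℚ`-isogeny `θ : E₀ → W` of degree `d` divisible by `p` would give `W` (via the dual isogeny) a
   rational subgroup of order `p`, contradicting the irreducibility of `E[p]`; so `p ∤ d`. Then
   `θ^*ω_W = a · ω_{E₀}` with `a ∈ ℤ`, `a ∣ d` (Néron mapping property; tree named fact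
   `integral_neronScaling_of_isGloballyMinimal`), `a Λ_{E₀} ⊆ Λ_W` has index `d`, and
   `[re Λ_W : re (a Λ_{E₀})] = e ∣ d`, whence `Ω(W) = (|a|/e) · Ω(E₀)` with `a, e` prime to `p` —
   Greenberg–Vatsal 2000, §3, Remark 3.4: "If `E` does not admit any `p`-isogenies, so that `E[p]`
   is irreducible, then it is clear that the Néron periods of any isogenous curve differ from those
   of `E` by a `p`-adic unit."
So `Ω(W) = u · Ω⁺_f` with `u = |c₀| · |a| / e ∈ ℚ`, `|u|_p = 1`. (This is the comparison
invoked, after Greenberg–Vatsal, wherever the Néron-normalised `p`-adic `L`-function `L_p(E)` is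
matched with that of `f_E` under (irr), e.g. by Skinner–Urban 2014 in their main theorems for
elliptic curves.)

In the tree the conclusion is proved only for all but finitely many `p`
(`Summit.BirchSwinnertonDyer.BirchSwinnertonDyer.Theorems.stub_maninPeriodCofinite`, from
Edixhoven's `m · Ω(W) = |c| · Ω⁺_f`); steps 2–3 at a GIVEN good `p` are not formalised (the
Manin-constant facts are statements only; the tree's point-set isogenies carry no Néron models).
Literature-prover triage: size L; no `_holds` here.

## References

* R. Greenberg, V. Vatsal, *On the Iwasawa invariants of elliptic curves*, Invent. Math. 142
  (2000) 17–63 = arXiv:math/9906215, §3, Remark 3.4 (held text). [GreenbergVatsal2000]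
* A. Abbes, E. Ullmo, Compositio Math. 103 (1996) 269–286 (on the Manin constant of modular
  elliptic curves), Thm. A. [AbbesUllmo1996]
* B. Mazur, *Rational isogenies of prime degree*, Invent. Math. 44 (1978), Cor. 4.1. [Mazur1978]
* B. Edixhoven, *On the Manin constants of modular elliptic curves*, Progr. Math. 89 (1991),
  Prop. 2 and §1. [EdixhovenManin1991]
* A. Agashe, K. Ribet, W. A. Stein, *The Manin constant*, PAMQ 2 (2006), Thm. 2.6.
  [AgasheRibetStein2006]
-/

noncomputable section

open scoped MatrixGroups ModularForm

open CongruenceSubgroup Literature.NumberTheory.EllipticCurves.ModularForms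

namespace Literature.NumberTheory.EllipticCurves

/-- **The Néron period is a rational `p`-adic-unit multiple of the lattice period of the newform
when `p ∤ N` and `E[p]` is irreducible** (Greenberg–Vatsal 2000, §3, Remark 3.4, with the Manin
constant at a prime `p ∤ N`: Abbes–Ullmo 1996, Thm. A / Mazur 1978, Cor. 4.1, and Edixhoven
1991, Prop. 2 for `Λ(ω_{E₀}) = c₀ Λ_f`; see the module docstring for the three-step chain).
For a globally minimal elliptic `W/ℚ`, a prime `p ≥ 5` of good reduction at which
`ρ̄_{E,p}` is irreducible (`HasIrreducibleModPGaloisRep`), and the newform `f ∈ S₂(Γ₀(N))` of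
`W` (`IsNewformOf W f`, any level `N`; it is the conductor, Carayol): there is `u ∈ ℚ` with
`|u|_p = 1` and `Ω(W) = u · Ω⁺_f`, where `Ω(W) = W.realPeriodRat` (Néron period, components
included) and `Ω⁺_f = plusPeriod f` (`re Λ_f = ℤ · Ω⁺_f/2`). Explicitly `u = |c₀| · |a| / e`
with `c₀` the Manin constant of the strong Weil curve `E₀` (`p ∤ c₀` as `p ∤ N`), `a ∣ d` the
Néron scaling and `e ∣ d` the real-lattice index of a cyclic isogeny `E₀ → W` of degree `d`,
`p ∤ d` because no curve of the class has a rational `p`-isogeny. Weaker than the sources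
(only `p ≥ 5` good, conclusion only up to a rational `p`-adic unit). Size L; no `_holds`.
[cite: GreenbergVatsal2000, §3, Remark 3.4; AbbesUllmo1996, Thm. A; Mazur1978, Cor. 4.1; EdixhovenManin1991, Prop. 2 and §1] -/
def realPeriodRat_eq_unit_mul_plusPeriod : Prop :=
  ∀ (W : WeierstrassCurve ℚ) [W.IsElliptic] [W.IsGloballyMinimal] (p : ℕ) [Fact p.Prime],
    5 ≤ p → W.HasGoodReductionAtPrime p → W.HasIrreducibleModPGaloisRep p →
    ∀ {N : ℕ} [NeZero N] (f : CuspForm (Gamma0 N) 2), IsNewformOf W f →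
    ∃ u : ℚ, ‖(u : ℚ_[p])‖ = 1 ∧ W.realPeriodRat = u * plusPeriod f

/-- **The same comparison at the prime `p = 3`** (Greenberg–Vatsal 2000, §3, Remark 3.4, with the
Manin constant at an ODD prime `p` with `p² ∤ 4N`: Mazur 1978, Cor. 4.1 — for `p = 3 ∤ N`, i.e. good
reduction at `3`, `9 ∤ 4N` — and Edixhoven 1991, Prop. 2 for `Λ(ω_{E₀}) = c₀ Λ_f`; the three-step
chain of the module docstring verbatim with `p = 3`: step 2 reads "`3 ∤ c₀` because `3 ∤ N`" from
Mazur's corollary alone, step 3 "no curve of the isogeny class has a rational `3`-isogeny, as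
`E[3]` is irreducible" exactly as printed in Greenberg–Vatsal's Remark 3.4, which has no restriction
on the prime). For a globally minimal elliptic `W/ℚ` with good reduction at `3` and `ρ̄_{E,3}`
irreducible, and the newform `f ∈ S₂(Γ₀(N))` of `W`: there is `u ∈ ℚ` with `|u|_3 = 1` and
`Ω(W) = u · Ω⁺_f`. Stated separately from `realPeriodRat_eq_unit_mul_plusPeriod` (whose `5 ≤ p` is
kept as landed; consumers exist) for the analytic-rank-`3` case of the crux `PlecticLegs.TwistSupply`
(stmt-BirchSwinnertonDyer-18260, line `Sketch`), where it supplies the period hypothesis of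
Sakamoto's mod-`3` Kurihara-number theorem. Weaker than the sources. Size L; no `_holds`.
[cite: GreenbergVatsal2000, §3, Remark 3.4; Mazur1978, Cor. 4.1; EdixhovenManin1991, Prop. 2 and §1] -/
def realPeriodRat_eq_unit_mul_plusPeriod_three : Prop :=
  ∀ (W : WeierstrassCurve ℚ) [W.IsElliptic] [W.IsGloballyMinimal],
    W.HasGoodReductionAtPrime 3 → W.HasIrreducibleModPGaloisRep 3 →
    ∀ {N : ℕ} [NeZero N] (f : CuspForm (Gamma0 N) 2), IsNewformOf W f →
    ∃ u : ℚ, ‖(u : ℚ_[3])‖ = 1 ∧ W.realPeriodRat = u * plusPeriod f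

/-- **The same comparison at a MULTIPLICATIVE prime `p ≥ 5`** (Greenberg–Vatsal 2000, §3,
Remark 3.4, with the Manin constant at an odd prime `p` with `p² ∤ N`: Mazur 1978, Cor. 4.1 — tree
fact `mazur_not_dvd_maninConstant_of_odd` — and Edixhoven 1991, Prop. 2 for `Λ(ω_{E₀}) = c₀ Λ_f`; the
three-step chain of the module docstring verbatim with "`p ∤ c₀` because `p` is odd and `p ∥ N`, so
`p² ∤ N`" (Mazur's corollary; Abbes–Ullmo is not needed) in step 2, step 3 unchanged: no curve of the
isogeny class has a rational `p`-isogeny because `E[p]` is irreducible, so the Néron periods of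
isogenous curves differ by `p`-adic units, Greenberg–Vatsal Rem. 3.4 — a remark with no condition on
the reduction at `p`; this is also the period comparison behind the "Manin constant" remark of
C.-H. Kim, Amer. J. Math. 148 (2026), §1.3.5: "The Manin constant is not divisible by a prime `p ≥ 3`
if `E` has semi-stable reduction at `p` [Mazur]"). For a globally minimal elliptic `W/ℚ`, a prime
`p ≥ 5` of MULTIPLICATIVE reduction (`p ∥ N`) at which `ρ̄_{E,p}` is irreducible, and the newform
`f ∈ S₂(Γ₀(N))` of `W`: there is `u ∈ ℚ` with `|u|_p = 1` and `Ω(W) = u · Ω⁺_f`. Stated separately from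
`realPeriodRat_eq_unit_mul_plusPeriod` (good `p`; landed, consumers exist) for the residual cell
`b2b-bsdres` (class X11, prover x11a gen 12), where it supplies the period hypothesis of the Kim-type
facts `Kim2022_rankZero_padicValRat_sha_of_kuriharaNumber_ne_zero` /
`Kim2022_rankOne_card_sha_eq_one_of_kuriharaNumber_ne_zero` (`KuriharaNumberKimShaLength`) at `p ∥ N`.
Weaker than the sources (only `p ≥ 5`, conclusion only up to a rational `p`-adic unit). Size L; no
`_holds`.
[cite: GreenbergVatsal2000, §3, Remark 3.4; Mazur1978, Cor. 4.1; EdixhovenManin1991, Prop. 2 and §1] -/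
def realPeriodRat_eq_unit_mul_plusPeriod_of_multiplicative : Prop :=
  ∀ (W : WeierstrassCurve ℚ) [W.IsElliptic] [W.IsGloballyMinimal] (p : ℕ) [Fact p.Prime],
    5 ≤ p → W.HasMultiplicativeReductionAtPrime p → W.HasIrreducibleModPGaloisRep p →
    ∀ {N : ℕ} [NeZero N] (f : CuspForm (Gamma0 N) 2), IsNewformOf W f →
    ∃ u : ℚ, ‖(u : ℚ_[p])‖ = 1 ∧ W.realPeriodRat = u * plusPeriod f

/-- **The same comparison at a GOOD prime `p = 2`** (Greenberg–Vatsal 2000, §3, Remark 3.4, the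
three-step chain of the module docstring verbatim at `p = 2`: step 1 Edixhoven 1991 Prop. 2
`Λ(ω_{E₀}) = c₀ Λ_f` — note `Ω(E₀) = c₀·Ω⁺_f` in both the rectangular (`Ω(E₀) = 2Ω₀`, `re Λ = ℤΩ₀`)
and the rhombic (`Ω(E₀) = Ω₀`, `re Λ = ℤΩ₀/2`) case, so the real-period normalisations introduce no
stray factor `2`; step 2 "`2 ∤ c₀`" is Abbes–Ullmo 1996, Thm. A — "if `p ∣ c_E` then `p ∣ N`" for
EVERY prime `p`, here `p = 2 ∤ N` (quoted as Thm. 2.5 of Agashe–Ribet–Stein, PAMQ 2 (2006); Mazur's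
Cor. 4.1 `p² ∣ 4N` is void at `2`); step 3 unchanged: `E[2]` irreducible ⇒ no curve of the isogeny
class has a rational `2`-isogeny ⇒ the Néron scaling `a` and the real-lattice index `e` divide an ODD
isogeny degree). For a globally minimal elliptic `W/ℚ` with good reduction at `2` and `ρ̄_{E,2}`
irreducible (automatic when `W` is good supersingular at `2`), and the newform `f ∈ S₂(Γ₀(N))` of `W`:
there is `u ∈ ℚ` with `|u|₂ = 1` and `Ω(W) = u · Ω⁺_f`. Stated separately from
`realPeriodRat_eq_unit_mul_plusPeriod` (`5 ≤ p`, landed, consumers exist) for the W-ALL cell's item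
stmt-BirchSwinnertonDyer-20307 (skeleton line `rankzero`, stub `stub_analyticMuCMTwo`), where it makes
the period ratio `ϖ = Ω⁺_f/Ω(W)` of the Néron-normalised signed `2`-adic `L`-function a `2`-adic unit. Weaker than the sources (conclusion only up to a
rational `2`-adic unit). Size L; no `_holds`.
[cite: AbbesUllmo1996, Thm. A; GreenbergVatsal2000, §3, Remark 3.4; EdixhovenManin1991, Prop. 2 and §1] -/
def realPeriodRat_eq_unit_mul_plusPeriod_two : Prop :=
  ∀ (W : WeierstrassCurve ℚ) [W.IsElliptic] [W.IsGloballyMinimal],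
    W.HasGoodReductionAtPrime 2 → W.HasIrreducibleModPGaloisRep 2 →
    ∀ {N : ℕ} [NeZero N] (f : CuspForm (Gamma0 N) 2), IsNewformOf W f →
    ∃ u : ℚ, ‖(u : ℚ_[2])‖ = 1 ∧ W.realPeriodRat = u * plusPeriod f

end Literature.NumberTheory.EllipticCurves

end
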